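import Summits.HodgeConjecture.HodgeCM.Automorphic.SignRecipeEndStateAllChars_1

/-! PORT of `HodgeCM/Automorphic/SignRecipeEndStateAllChars.lean` (HodgeCMPerL run 82) — part 2: continuation of `Summits.HodgeConjecture.HodgeCM.Automorphic.SignRecipeEndStateAllChars_1` (split at a top-level declaration boundary by port_pkg.py; scope re-opened below; declarations unchanged). -/

-- port_pkg: scope re-opened for this part (file-level context, then the namespace/section stack open at the cut)
set_option autoImplicit false
noncomputable section
open scoped InnerProductSpace
open NumberField
namespace HodgeCM
namespace Universe
open HodgeCM.Prior.Perl34File HodgeCM.Prior.Perl34File.Perl34 HodgeCM.PerL34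
variable {U : Universe}
namespace SideData

variable {L : Type} [Field L] [NumberField L] [IsCMField L]

/-- Forget the allowed-pair predicate. -/
def arch (d : SideData L) : SideArchType L := ⟨d.m₁, d.m₂⟩

/-- The same side data with every character allowed. -/
def allChars (d : SideData L) : SideData L := ⟨d.m₁, d.m₂, fun _ => True⟩

end SideData

namespace SideArchType

variable {L : Type} [Field L] [NumberField L] [IsCMField L]

/-- Side data of an archimedean type: every character of that type allowed. -/
def side (w : SideArchType L) : SideData L := ⟨w.m₁, w.m₂, fun _ => True⟩

/-- (Ported verbatim from the HodgeCMPerL package; no docstring in the source.) -/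
@[simp] theorem side_allowed (w : SideArchType L) (χ : ↥(SeesawTorus.allowedChars L w.m₁ w.m₂)) :
    w.side.allowed χ ↔ True := Iff.rfl

/-- (Ported verbatim from the HodgeCMPerL package; no docstring in the source.) -/
theorem side_arch (w : SideArchType L) : w.side.arch = w := rfl

end SideArchType

/-- (Ported verbatim from the HodgeCMPerL package; no docstring in the source.) -/
theorem SideData.arch_side {L : Type} [Field L] [NumberField L] [IsCMField L] (d : SideData L) :
    d.arch.side = d.allChars := rfl

namespace AdelicThetaCore

variable {hP : PrintFact_unitaryCompact} (C : U.AdelicThetaCore hP) (h : Bool)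
variable (d12 d34 : ∀ {L : CMField}, SeesawCtx L → SideData L)
variable (w12 w34 : ∀ {L : CMField}, SeesawCtx L → SideArchType L)

/-- **The theta model of the all-characters END STATE**: core `C`, convention bit `h`, and per context the
archimedean types `w12 c`, `w34 c` of the two torus sides — nothing else. -/
abbrev thetaModelArch : U.ThetaModel :=
  C.thetaModel h (fun c => (w12 c).side) (fun c => (w34 c).side)

/-- Forgetting the allowed-pair predicates of the side data IS passing to `allChars` (definitionally, through the
whole carrier chain). -/
theorem thetaModel_allChars :
    (C.thetaModel h d12 d34).allChars = C.thetaModelArch h (fun c => (d12 c).arch) (fun c => (d34 c).arch) := rfl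

/-- Every (12)-character of the all-characters END STATE's model is allowed. -/
theorem thetaModelArch_allowed12 {L : CMField} {ι₁ : L →+* ℂ} (V : HermSpace3 L ι₁) (c : SeesawCtx L)
    (χ : ((C.thetaModelArch h w12 w34).t12 V c).X) : ((C.thetaModelArch h w12 w34).t12 V c).allowed χ := trivial

/-- Every (34)-character of the all-characters END STATE's model is allowed. -/
theorem thetaModelArch_allowed34 {L : CMField} {ι₁ : L →+* ℂ} (V : HermSpace3 L ι₁) (c : SeesawCtx L)
    (χ : ((C.thetaModelArch h w12 w34).t34 V c).X) : ((C.thetaModelArch h w12 w34).t34 V c).allowed χ := trivial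

/-- **`Open_chars` (N31) of the all-characters END STATE's model — a THEOREM.** -/
theorem thetaModelArch_chars : (C.thetaModelArch h w12 w34).Open_chars := by
  intro L ι₁ V c _
  exact ⟨C.thetaModelArch_allowed12 h w12 w34 V c, C.thetaModelArch_allowed34 h w12 w34 V c⟩

/-- For the all-characters END STATE's model the eight inputs of record ARE the seven all-characters inputs. -/
theorem thetaModelArch_nonDesignInputs_iff :
    (C.thetaModelArch h w12 w34).NonDesignInputs ↔ (C.thetaModelArch h w12 w34).AllCharsNonDesign :=
  (C.thetaModelArch h w12 w34).nonDesignInputs_iff_allChars_of_allowed (C.thetaModelArch_allowed12 h w12 w34)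
    (C.thetaModelArch_allowed34 h w12 w34)

end AdelicThetaCore

end Universe

/-! ## END STATE -/

namespace Assembly

open HodgeCM.Universe (AdelicThetaCore AdelicThetaCore₀ SideArchType SideData ThetaModel)

variable (U : Universe)

/-- **END STATE of part (a), `chars` eliminated — `RealisationExistsPerL ∧ RealisationExistsFace`.**  Hypotheses: the
model facts `M`; PerL's convention bit `h`; the core DATA `C` (`U(V₃)(𝔸_f)` compact by the in-package theorem
`printFact_unitaryCompact_holds`); per context the torus-side data `d12 c`, `d34 c` (of which only the archimedean
types are used: `thetaModel_allChars`); the SEVEN all-characters non-design inputs (2 PRINT + 5 OPEN: N12, N33,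
N19w^all, N19g^all, N29); Hodge–Riemann.  Versus the END STATE of record `realisationExists_ofSignRecipe₀` (EIGHT
inputs): `chars` (N31 = PerL Lemma 4.2(b)) is no longer an input, and by `realisationExists_ofSignRecipe₀_of₇` the
END STATE of record is the special case obtained through `NonDesignInputs.allChars`. -/
theorem realisationExists_ofSignRecipe₇ (M : U.ModelAxioms) (h : Bool) (C : U.AdelicThetaCore₀)
    (d12 d34 : ∀ {L : CMField}, SeesawCtx L → SideData L)
    (A : (C.thetaModel h d12 d34).AllCharsNonDesign) (hHR : U.Fact_hodgeRiemann20) :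
    U.RealisationExistsPerL ∧ U.RealisationExistsFace :=
  (C.thetaModel h d12 d34).realisationExists_allChars M A (C.design_kappaConj h d12 d34)
    (C.design_frameSignConj h d12 d34) hHR

/-- **PerL, `chars` eliminated.** -/
theorem perL_ofSignRecipe₇ (M : U.ModelAxioms) (h : Bool) (C : U.AdelicThetaCore₀)
    (d12 d34 : ∀ {L : CMField}, SeesawCtx L → SideData L)
    (A : (C.thetaModel h d12 d34).AllCharsNonDesign) (hHR : U.Fact_hodgeRiemann20) : U.PerL :=
  (C.thetaModel h d12 d34).perL_allChars M A (C.design_kappaConj h d12 d34) (C.design_frameSignConj h d12 d34) hHR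

/-- **COR-CM, END STATE with `chars` eliminated** (hypotheses: `M`, M29/M30, the three [QW8]-side inputs, `h`, `C`,
`d12`/`d34`, the SEVEN all-characters inputs, Hodge–Riemann). -/
theorem COR_CM_endState_ofSignRecipe₇ (M : U.ModelAxioms) (h29 : U.Fact_weightSpan)
    (h30 : U.Fact_weightHodge) (hE : U.Qw8ExtProd) (hD : U.Qw8DualPushPull) (hMi : U.Qw8Milne) (h : Bool)
    (C : U.AdelicThetaCore₀) (d12 d34 : ∀ {L : CMField}, SeesawCtx L → SideData L)
    (A : (C.thetaModel h d12 d34).AllCharsNonDesign) (hHR : U.Fact_hodgeRiemann20) : U.HC_CM :=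
  (C.thetaModel h d12 d34).COR_CM_endState_allChars M h29 h30 hE hD hMi A (C.design_kappaConj h d12 d34)
    (C.design_frameSignConj h d12 d34) hHR

/-- **The END STATE of record is recovered** from the all-characters one by monotonicity. -/
theorem realisationExists_ofSignRecipe₀_of₇ (M : U.ModelAxioms) (h : Bool) (C : U.AdelicThetaCore₀)
    (d12 d34 : ∀ {L : CMField}, SeesawCtx L → SideData L)
    (A : (C.thetaModel h d12 d34).NonDesignInputs) (hHR : U.Fact_hodgeRiemann20) :
    U.RealisationExistsPerL ∧ U.RealisationExistsFace :=
  realisationExists_ofSignRecipe₇ U M h C d12 d34 A.allChars hHR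

/-- **END STATE over archimedean types only**: core `C`, bit `h`, per context and side the archimedean type
`(m₁, m₂)`; the eight inputs of record of THIS model, of which `chars` is a theorem (`thetaModelArch_chars`) — so
seven remain (`thetaModelArch_nonDesignInputs_iff`). -/
theorem realisationExists_ofArchTypes (M : U.ModelAxioms) (h : Bool) (C : U.AdelicThetaCore₀)
    (w12 w34 : ∀ {L : CMField}, SeesawCtx L → SideArchType L)
    (A : (C.thetaModelArch h w12 w34).AllCharsNonDesign) (hHR : U.Fact_hodgeRiemann20) :
    U.RealisationExistsPerL ∧ U.RealisationExistsFace :=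
  realisationExists_ofSignRecipe₀ U M h C (fun c => (w12 c).side) (fun c => (w34 c).side)
    ((C.thetaModelArch_nonDesignInputs_iff h w12 w34).mpr A) hHR

/-- The inputs of record of ANY side data give the all-characters inputs of the archimedean-types-only model with
the same types (monotonicity transported along `thetaModel_allChars`). -/
theorem allCharsNonDesign_arch_of_nonDesign (h : Bool) (C : U.AdelicThetaCore₀)
    (d12 d34 : ∀ {L : CMField}, SeesawCtx L → SideData L) (A : (C.thetaModel h d12 d34).NonDesignInputs) :
    (C.thetaModelArch h (fun c => (d12 c).arch) (fun c => (d34 c).arch)).NonDesignInputs := by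
  rw [← C.thetaModel_allChars h d12 d34]
  exact ((C.thetaModel h d12 d34).allChars_nonDesignInputs_iff).mpr A.allChars

end Assembly

end HodgeCM

end
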